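import Literature.AnabelianGeometry.SemiGraphs.StarSubSemiGraph
import Literature.AnabelianGeometry.SemiGraphs.AmbientVocabConnected
import Literature.AnabelianGeometry.SemiGraphs.SubdivisionLemmas

/-!
# The full star on two vertices joined by an edge is connected ([SemiAnbd] §1 p.12, §4 p.51, Prop 4.7 p.57)

Mochizuki, *Semi-graphs of anabelioids*, Publ. RIMS **42** (2006), §1 pp.11–13 (the topological space of
a semi-graph; connected semi-graphs), §4 p.51 l.−4 (a finite open object is "a finite, connected, …
semi-graph of anabelioids"), proof of Prop 4.7 p.57 l.38–40 ("if we take `H₃` to be the link contained in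
`𝒢₃` which is determined by the images `v₃`, `e₃` of `v′`, `e′`" — print's calligraphic `𝒢₃`, a
semi-graph of anabelioids; the cell's `𝔾₃` denotes its underlying semi-graph) (kurims
`paper:url-f33ace170ff4`). [cite: MochizukiSemiAnbd2006, §1, p. 12]

PROOF-ONLY brick B2′ of the L3 lead's row «PROP47@REAL-CONSTRUCTION», item (γ) (cell abc-iut, layer L3,
seat abc-iut-L3-t12 gen 10; over brick B1 `StarSubSemiGraph.lean`): in abc-iut-L3-t1's rendering of
connectedness (`SemiGraph.IsConnected`: the barycentric subdivision on vertex-, edge- and branch-points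
is a connected simple graph),

* `SemiGraph.reachable_edge_vertex` — an edge-point reaches the vertices of its abutting branches
  (from the incidence steps of `SubdivisionLemmas.lean`);
* `SemiGraph.starSubgraph_reachable_inl` — in a full star `starSubgraph G S`, every point reaches a
  vertex of `S` (every edge of the star abuts inside `S`);
* ★ `SemiGraph.isConnected_starSubgraph_pair` — **the full star on `{v, v′}` is connected as soon as an
  edge of `G` joins `v` and `v′`** (the closed edge `e₃` of the star-link);
* `SgAQuot.SgA.starAt_isConnected_pair` and, at the real vocabulary, `starAt_isConnected_pair_ofReal` —
  the clause `isConnected` of the finite-open datum of the star-link carrier `X.starAt {v₃, v₃′}` of brick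
  B1 (memo `HOME/staging/L3/L3-t12/g10/SHAPES-gamma-LinkInCovering.md` §4), via abc-iut-L3-t3's dictionary
  `SemiAnbdVocab.ofReal_isConnected_iff`.

READING PROVISO (L3 lead gen 8, F106 ruling): the full star on `{v₃, v₃′}` is the underlying object of
print's link of Prop 4.7 only when, moreover, `e₃` is the UNIQUE closed edge of the covering joining `v₃`
and `v₃′` (links have edge-wise length exactly `1`, Def 4.2 (i) p.52; "untangled", §1 p.13, does not exclude
parallel closed edges); the statements below concern the full star and display no such identification.
Nothing printed is discharged (a constructor brick); typed ≠ proved; nothing here takes a side on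
[IUTchIII] Cor. 3.12.
-/

namespace Literature.AnabelianGeometry.SemiGraphs

open CategoryTheory

universe v₁ u₁ u

namespace SemiGraph

variable (G : SemiGraph.{u})

/-! ### 1. The incidences of the barycentric subdivision as reachability steps -/

/-- An edge-point reaches every vertex its edge abuts to (two incidence steps of the subdivision,
`SubdivisionLemmas.lean`). [cite: MochizukiSemiAnbd2006, §1, p. 11] -/
theorem reachable_edge_vertex (b : G.Branch) (v : G.Vertex) (h : G.abuts b = some v) :
    G.subdivision.Reachable (Sum.inr (Sum.inl (G.edgeOf b))) (Sum.inl v) :=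
  (G.subdivision_reachable_edge_branch b).trans (G.subdivision_reachable_branch_vertex h)

/-! ### 2. In a full star every point reaches a vertex of `S` -/

variable (S : Set G.Vertex)

/-- **In the full star on `S`, every point of the subdivision reaches some vertex of `S`**: a vertex
is one; an edge of the star abuts (in `G`, hence in the star) to a vertex of `S`; a branch-point reaches
its edge-point. [cite: MochizukiSemiAnbd2006, §1, p. 12] -/
theorem starSubgraph_reachable_inl (x : (G.starSubgraph S).toSemiGraph.Node) :
    ∃ w : (G.starSubgraph S).toSemiGraph.Vertex,
      (G.starSubgraph S).toSemiGraph.subdivision.Reachable x (Sum.inl w) := by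
  rcases x with w | (e | c)
  · exact ⟨w, SimpleGraph.Reachable.refl _⟩
  · obtain ⟨b, w, hbe, hbw⟩ := G.starSubgraph_edgeAbuts S e
    refine ⟨w, ?_⟩
    rw [← hbe]
    exact (G.starSubgraph S).toSemiGraph.reachable_edge_vertex b w hbw
  · -- a branch-point: back to its edge-point, which abuts inside `S`
    obtain ⟨b, w, hbe, hbw⟩ := G.starSubgraph_edgeAbuts S ((G.starSubgraph S).toSemiGraph.edgeOf c)
    refine ⟨w, ?_⟩
    have h1 := ((G.starSubgraph S).toSemiGraph.subdivision_reachable_edge_branch c).symm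
    have h2 := (G.starSubgraph S).toSemiGraph.reachable_edge_vertex b w hbw
    rw [hbe] at h2
    exact h1.trans h2

/-- **A full star is connected as soon as `S` is nonempty and its vertices are mutually reachable in
the star.** [cite: MochizukiSemiAnbd2006, §1, p. 12] -/
theorem isConnected_starSubgraph_of_reachable (w₀ : (G.starSubgraph S).toSemiGraph.Vertex)
    (h : ∀ w : (G.starSubgraph S).toSemiGraph.Vertex,
      (G.starSubgraph S).toSemiGraph.subdivision.Reachable (Sum.inl w) (Sum.inl w₀)) :
    (G.starSubgraph S).toSemiGraph.IsConnected := by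
  haveI : Nonempty (G.starSubgraph S).toSemiGraph.Node := ⟨Sum.inl w₀⟩
  refine ⟨⟨fun x y => ?_⟩⟩
  obtain ⟨w, hw⟩ := G.starSubgraph_reachable_inl S x
  obtain ⟨w', hw'⟩ := G.starSubgraph_reachable_inl S y
  exact (hw.trans (h w)).trans ((h w').symm.trans hw'.symm)

/-! ### 3. The full star on two vertices joined by an edge -/

variable {S}

/-- In the full star, two vertices of `S` joined by an edge of `G` are mutually reachable (through the
edge-point of that edge, which belongs to the star). [cite: MochizukiSemiAnbd2006, §1, p. 12] -/
theorem starSubgraph_reachable_of_joins {v v' : G.Vertex} (hv : v ∈ S) (hv' : v' ∈ S)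
    {e : G.Edge} (b₁ b₂ : G.Branch) (hb₁ : G.edgeOf b₁ = e) (hb₂ : G.edgeOf b₂ = e)
    (h₁ : G.abuts b₁ = some v) (h₂ : G.abuts b₂ = some v') :
    (G.starSubgraph S).toSemiGraph.subdivision.Reachable (Sum.inl ⟨v, hv⟩) (Sum.inl ⟨v', hv'⟩) := by
  have he : e ∈ (G.starSubgraph S).edges := hb₁ ▸ G.edgeOf_mem_starSubgraph_edges S hv h₁
  let c₁ : (G.starSubgraph S).toSemiGraph.Branch := ⟨b₁, by rw [hb₁]; exact he⟩
  let c₂ : (G.starSubgraph S).toSemiGraph.Branch := ⟨b₂, by rw [hb₂]; exact he⟩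
  have hc₁ := (G.starSubgraph S).abuts_eq_some_of c₁ v hv h₁
  have hc₂ := (G.starSubgraph S).abuts_eq_some_of c₂ v' hv' h₂
  have hedge : (G.starSubgraph S).toSemiGraph.edgeOf c₁ = (G.starSubgraph S).toSemiGraph.edgeOf c₂ :=
    Subtype.ext (hb₁.trans hb₂.symm)
  have r₁ := (G.starSubgraph S).toSemiGraph.reachable_edge_vertex c₁ ⟨v, hv⟩ hc₁
  have r₂ := (G.starSubgraph S).toSemiGraph.reachable_edge_vertex c₂ ⟨v', hv'⟩ hc₂
  rw [hedge] at r₁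
  exact r₁.symm.trans r₂

/-- **The full star on `{v, v′}` is CONNECTED as soon as an edge of `G` joins `v` and `v′`** (for the
star-link carrier of Prop 4.7's proof, p.57: `e₃` is closed with abutments `v₃`, `v₃′`; connectedness is a
clause of the finite-open datum, p.51). [cite: MochizukiSemiAnbd2006, §4, p. 51] -/
theorem isConnected_starSubgraph_pair (v v' : G.Vertex) {e : G.Edge} (b₁ b₂ : G.Branch)
    (hb₁ : G.edgeOf b₁ = e) (hb₂ : G.edgeOf b₂ = e) (h₁ : G.abuts b₁ = some v)
    (h₂ : G.abuts b₂ = some v') : (G.starSubgraph {v, v'}).toSemiGraph.IsConnected := by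
  have hv : v ∈ ({v, v'} : Set G.Vertex) := Set.mem_insert v _
  have hv' : v' ∈ ({v, v'} : Set G.Vertex) := Set.mem_insert_of_mem v rfl
  refine G.isConnected_starSubgraph_of_reachable {v, v'} ⟨v, hv⟩ fun w => ?_
  obtain ⟨w, hw⟩ := w
  rcases hw with rfl | hw
  · exact SimpleGraph.Reachable.refl _
  · rw [Set.mem_singleton_iff] at hw
    subst hw
    exact (G.starSubgraph_reachable_of_joins hv hv' b₁ b₂ hb₁ hb₂ h₁ h₂).symm

end SemiGraph

/-! ### 4. The star-link carrier is connected -/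

namespace SgAQuot.SgA

/-- **The full star `X.starAt {v, v′}` (brick B1) on two vertices joined by an edge is connected** (as a
semi-graph of anabelioids: its underlying semi-graph is). [cite: MochizukiSemiAnbd2006, §4, p. 51] -/
theorem starAt_isConnected_pair (X : SgA.{v₁, u₁, u}) (v v' : X.toSgA.graph.Vertex)
    {e : X.toSgA.graph.Edge} (b₁ b₂ : X.toSgA.graph.Branch) (hb₁ : X.toSgA.graph.edgeOf b₁ = e)
    (hb₂ : X.toSgA.graph.edgeOf b₂ = e) (h₁ : X.toSgA.graph.abuts b₁ = some v)
    (h₂ : X.toSgA.graph.abuts b₂ = some v') : (X.starAt {v, v'}).toSgA.IsConnected :=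
  ⟨X.toSgA.graph.isConnected_starSubgraph_pair v v' b₁ b₂ hb₁ hb₂ h₁ h₂⟩

/-- **At the real vocabulary `SemiAnbdVocab.ofReal R`, the star-link carrier is connected** — the clause
`isConnected` of its finite-open datum (abc-iut-L3-t3's dictionary `SemiAnbdVocab.ofReal_isConnected_iff`).
[cite: MochizukiSemiAnbd2006, §4, p. 51] -/
theorem starAt_isConnected_pair_ofReal (R : BridgeResidual.{v₁, u₁, u}) (X : SgA.{v₁, u₁, u})
    (v v' : X.toSgA.graph.Vertex) {e : X.toSgA.graph.Edge} (b₁ b₂ : X.toSgA.graph.Branch)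
    (hb₁ : X.toSgA.graph.edgeOf b₁ = e) (hb₂ : X.toSgA.graph.edgeOf b₂ = e)
    (h₁ : X.toSgA.graph.abuts b₁ = some v) (h₂ : X.toSgA.graph.abuts b₂ = some v') :
    (SemiAnbdVocab.ofReal R).IsConnected (X.starAt {v, v'}) :=
  (SemiAnbdVocab.ofReal_isConnected_iff R _).mpr
    (X.toSgA.graph.isConnected_starSubgraph_pair v v' b₁ b₂ hb₁ hb₂ h₁ h₂)

end SgAQuot.SgA

end Literature.AnabelianGeometry.SemiGraphs
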